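import Mathlib.Combinatorics.SimpleGraph.Walk.Counting
import Mathlib.Combinatorics.SimpleGraph.Paths
import Mathlib.Combinatorics.SimpleGraph.DeleteEdges
import Mathlib.Topology.Algebra.InfiniteSum.ENNReal
import Summits.CriticalPhenomena.SAWScalingLimit.Theorems.SAWTotalPositivityBoundaryTP2Defs
import Summits.CriticalPhenomena.SAWScalingLimit.Theorems.SAWTotalPositivityBoundaryTP2Kernel
import Summits.CriticalPhenomena.SAWScalingLimit.Theorems.SAWTotalPositivityBoundaryTP2Symmetry
import Summits.CriticalPhenomena.SAWScalingLimit.Theorems.SAWTotalPositivityBoundaryTP2Avoid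
import Summits.CriticalPhenomena.SAWScalingLimit.Theorems.SAWTotalPositivityBoundaryTP2InterlaceInherit
import Summits.CriticalPhenomena.SAWScalingLimit.Theorems.SAWTotalPositivityBoundaryTP2FirstStep
import HarnessLib

/-!
# Crux `BoundaryTP2` (stmt-CriticalPhenomena-7115), line `corner-deletion-induction`: `Main ≥ 0`

For the fugacity-`x` self-avoiding path kernel `Z = pathKernel H x` and the corner `p₃` of an interlaced,
pairwise distinct quadruple `p₁ p₂ p₃ p₄` of a graph `H`, the corner recursion writes the TP₂ determinant as
`Main + Corr` with `Main = x · (S⁺ − S⁻)`,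

  `S⁺ = Σ_{u ∼ p₃} A(p₁,p₂) · A(u,p₄)`,  `S⁻ = Σ_{u ∼ p₃} A(p₁,u) · A(p₂,p₄)`,

where `A(a,b) = pathKernelOn H x a b {γ | p₃ ∉ γ}` is the kernel of the paths avoiding the corner, i.e. the
kernel of the vertex-deleted graph `H − p₃ = H.deleteEdges (H.incidenceSet p₃)` (`stub_pathKernelOn_avoid`).
This file proves the registered stub `stub_mainNonneg` of the line's skeleton: **`S⁻ ≤ S⁺` follows from the
induction hypothesis** "interlacing-only TP₂ at `x` on every proper subgraph of `H`", at any corner `p₃`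
having a neighbour other than `p₄`. The comparison is termwise in the neighbour `u` of `p₃`:

* `u ∉ {p₁, p₂, p₄}`: the term is the TP₂ instance `(p₁, p₂, u, p₄)` of the proper subgraph `H − p₃`
  (interlacing is inherited: `stub_interlaced_deleteVert`);
* `u = p₂`: both terms are `A(p₁,p₂) A(p₂,p₄)`;
* `u = p₄`: `A(p₁,p₄) A(p₂,p₄) ≤ A(p₁,p₂)` is the TP₂ instance `(p₁, p₂, p₃, p₄)` of the proper subgraph
  `G = (H − p₃) + edge p₃p₄` (proper because `p₃` has another neighbour), in which `p₃` is a pendant vertex: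
  `Z_G(p₃,p₄) = x`, `Z_G(p₁,p₃) = x · A(p₁,p₄)`, `Z_G(p₁,p₂) = A(p₁,p₂)`, `Z_G(p₂,p₄) = A(p₂,p₄)`, and
  `x > 0` cancels;
* `u = p₁`: interlacing applied to the one-edge path `p₁ p₃` forces every path `p₂ → p₄` of `H − p₃`
  through `p₁`, and cutting there gives `A(p₂,p₄) ≤ A(p₂,p₁) A(p₁,p₄)`.

Everything here is proved; Mathlib and the landed toolkit of the line only. [folklore]
-/

noncomputable section

namespace Summit.CriticalPhenomena.SAWScalingLimit.Theorems.BoundaryTP2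

open Literature.Probability.LatticeModels Literature.Probability.RandomPlanarGeometry
open scoped ENNReal

variable {V : Type*}

/-! ## Interlacing passes to subgraphs -/

/-- Interlacing is inherited by subgraphs on the same vertex type: a self-avoiding path of `G ≤ H` is a
self-avoiding path of `H` with the same vertices. [folklore] -/
theorem Interlaced.of_le {G H : SimpleGraph V} {p₁ p₂ p₃ p₄ : V} (h : Interlaced H p₁ p₂ p₃ p₄)
    (hle : G ≤ H) : Interlaced G p₁ p₂ p₃ p₄ := by
  intro P Q
  obtain ⟨v, hvP, hvQ⟩ := h ⟨P.1.mapLe hle, P.2.mapLe hle⟩ ⟨Q.1.mapLe hle, Q.2.mapLe hle⟩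
  rw [SimpleGraph.Walk.support_mapLe_eq_support] at hvP hvQ
  exact ⟨v, hvP, hvQ⟩

/-! ## Cutting at a forced vertex -/

/-- **Splitting at a forced vertex.** If every self-avoiding path `a → b` of `H` visits `c`, then for
`x ≥ 0`, `Z(a,b) ≤ Z(a,c) · Z(c,b)`: cutting a path at its visit of `c` (`takeUntil` / `dropUntil`) is an
injection into pairs of self-avoiding paths `a → c`, `c → b`, and the lengths add. [folklore] -/
theorem pathKernel_le_mul_of_forall_mem_support (H : SimpleGraph V) (x : ℝ) (hx : 0 ≤ x) {a b c : V}
    (h : ∀ P : H.Path a b, c ∈ P.1.support) :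
    pathKernel H x a b ≤ pathKernel H x a c * pathKernel H x c b := by
  classical
  let f : H.Path a b → H.Path a c × H.Path c b := fun P =>
    (⟨P.1.takeUntil c (h P), P.2.takeUntil _⟩, ⟨P.1.dropUntil c (h P), P.2.dropUntil _⟩)
  have hf1 : ∀ P, (f P).1.1 = P.1.takeUntil c (h P) := fun P => rfl
  have hf2 : ∀ P, (f P).2.1 = P.1.dropUntil c (h P) := fun P => rfl
  have hf : Function.Injective f := by
    intro P P' hPP'
    have h1 : P.1.takeUntil c (h P) = P'.1.takeUntil c (h P') := by
      rw [← hf1, ← hf1, hPP']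
    have h2 : P.1.dropUntil c (h P) = P'.1.dropUntil c (h P') := by
      rw [← hf2, ← hf2, hPP']
    refine Subtype.ext ?_
    calc P.1 = (P.1.takeUntil c (h P)).append (P.1.dropUntil c (h P)) := (P.1.take_spec (h P)).symm
      _ = (P'.1.takeUntil c (h P')).append (P'.1.dropUntil c (h P')) := by rw [h1, h2]
      _ = P'.1 := P'.1.take_spec (h P')
  have hlen : ∀ P, (f P).1.1.length + (f P).2.1.length = P.1.length := fun P => by
    rw [hf1, hf2, ← SimpleGraph.Walk.length_append, SimpleGraph.Walk.take_spec]
  calc pathKernel H x a b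
      = ∑' P : H.Path a b,
          ENNReal.ofReal (x ^ (f P).1.1.length) * ENNReal.ofReal (x ^ (f P).2.1.length) := by
        refine tsum_congr fun P => ?_
        rw [← ENNReal.ofReal_mul (pow_nonneg hx _), ← pow_add, hlen]
    _ ≤ ∑' q : H.Path a c × H.Path c b,
          ENNReal.ofReal (x ^ q.1.1.length) * ENNReal.ofReal (x ^ q.2.1.length) :=
        ENNReal.tsum_comp_le_tsum_of_injective hf (fun q : H.Path a c × H.Path c b =>
          ENNReal.ofReal (x ^ q.1.1.length) * ENNReal.ofReal (x ^ q.2.1.length))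
    _ = ∑' (α : H.Path a c) (β : H.Path c b),
          ENNReal.ofReal (x ^ α.1.length) * ENNReal.ofReal (x ^ β.1.length) :=
        ENNReal.tsum_prod (f := fun (α : H.Path a c) (β : H.Path c b) =>
          ENNReal.ofReal (x ^ α.1.length) * ENNReal.ofReal (x ^ β.1.length))
    _ = ∑' α : H.Path a c,
          ENNReal.ofReal (x ^ α.1.length) * ∑' β : H.Path c b, ENNReal.ofReal (x ^ β.1.length) :=
        tsum_congr fun _ => ENNReal.tsum_mul_left
    _ = (∑' α : H.Path a c, ENNReal.ofReal (x ^ α.1.length)) *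
          ∑' β : H.Path c b, ENNReal.ofReal (x ^ β.1.length) := ENNReal.tsum_mul_right
    _ = pathKernel H x a c * pathKernel H x c b := rfl

/-! ## A pendant vertex -/

/-- A vertex `c` all of whose neighbours equal `v` (a pendant vertex, or an isolated one) is never an
interior vertex of a self-avoiding path: a self-avoiding path between two vertices different from `c` does
not visit `c`. [folklore] -/
private theorem notMem_support_of_pendant {G : SimpleGraph V} {c v : V} (hG : ∀ w, G.Adj c w → w = v) :
    ∀ {a b : V} (p : G.Walk a b), p.IsPath → a ≠ c → b ≠ c → c ∉ p.support := by
  intro a b p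
  induction p with
  | nil =>
    intro _ ha _ hc
    rw [SimpleGraph.Walk.support_nil, List.mem_singleton] at hc
    exact ha hc.symm
  | @cons a a' b had q ih =>
    intro hp ha hb hc
    rw [SimpleGraph.Walk.cons_isPath_iff] at hp
    rw [SimpleGraph.Walk.support_cons, List.mem_cons] at hc
    rcases hc with hc | hc
    · exact ha hc.symm
    · by_cases hac : a' = c
      · subst hac
        -- `a` is a neighbour of the pendant vertex, hence `a = v`; the next vertex of the path is
        -- again a neighbour of the pendant vertex, hence `= v = a`: the path revisits `a`
        have hav : a = v := hG a had.symm
        cases q with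
        | nil => exact hb rfl
        | cons had' q' =>
          have hv' := hG _ had'
          refine hp.2 ?_
          rw [SimpleGraph.Walk.support_cons, List.mem_cons]
          refine Or.inr ?_
          rw [hav, ← hv']
          exact q'.start_mem_support
      · exact ih hp.1 hac hb hc

/-- The neighbourhood of a pendant vertex. [folklore] -/
private theorem neighborSet_pendant {G : SimpleGraph V} {c v : V} (hG : ∀ w, G.Adj c w → w = v)
    (hcv : G.Adj c v) : G.neighborSet c = {v} := by
  ext w
  rw [SimpleGraph.mem_neighborSet, Set.mem_singleton_iff]
  exact ⟨hG w, fun h => h ▸ hcv⟩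

/-- First step at a pendant vertex `c` with neighbour `v`: `Z_G(c,b) = x · Z_{G−c}(v,b)` for `b ≠ c`.
[folklore] -/
private theorem pathKernel_pendant_from {G : SimpleGraph V} {c v : V} (hG : ∀ w, G.Adj c w → w = v)
    (hcv : G.Adj c v) (x : ℝ) (hx : 0 ≤ x) {b : V} (hb : b ≠ c) :
    pathKernel G x c b = ENNReal.ofReal x * pathKernel (G.deleteEdges (G.incidenceSet c)) x v b := by
  rw [stub_pathKernel_firstStep G x hx c b hb.symm,
    tsum_congr_set_coe (fun w => pathKernelOn G x w b {γ | c ∉ γ.1.support}) (neighborSet_pendant hG hcv),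
    tsum_singleton v (fun w => pathKernelOn G x w b {γ | c ∉ γ.1.support}),
    stub_pathKernelOn_avoid G x v b c hcv.ne.symm hb]

/-- At a pendant vertex `c` with neighbour `v`, the pendant edge is the only self-avoiding path `c → v`:
`Z_G(c,v) = x`. [folklore] -/
private theorem pathKernel_pendant_edge {G : SimpleGraph V} {c v : V} (hG : ∀ w, G.Adj c w → w = v)
    (hcv : G.Adj c v) (x : ℝ) (hx : 0 ≤ x) : pathKernel G x c v = ENNReal.ofReal x := by
  rw [pathKernel_pendant_from hG hcv x hx hcv.ne.symm, pathKernel_self, mul_one]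

/-- At a pendant vertex `c` with neighbour `v`: `Z_G(a,c) = x · Z_{G−c}(a,v)` for `a ≠ c` (every
self-avoiding path `a → c` ends with the pendant edge). [folklore] -/
private theorem pathKernel_pendant_to {G : SimpleGraph V} {c v : V} (hG : ∀ w, G.Adj c w → w = v)
    (hcv : G.Adj c v) (x : ℝ) (hx : 0 ≤ x) {a : V} (ha : a ≠ c) :
    pathKernel G x a c = ENNReal.ofReal x * pathKernel (G.deleteEdges (G.incidenceSet c)) x a v := by
  rw [pathKernel_comm, pathKernel_pendant_from hG hcv x hx ha, pathKernel_comm]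

/-- Away from a pendant vertex `c` the kernel does not see `c`: `Z_G(a,b) = Z_{G−c}(a,b)` for `a, b ≠ c`
(no self-avoiding path `a → b` visits `c`). [folklore] -/
private theorem pathKernel_pendant_other {G : SimpleGraph V} {c v : V} (hG : ∀ w, G.Adj c w → w = v)
    (x : ℝ) {a b : V} (ha : a ≠ c) (hb : b ≠ c) :
    pathKernel G x a b = pathKernel (G.deleteEdges (G.incidenceSet c)) x a b := by
  rw [← stub_pathKernelOn_avoid G x a b c ha hb, pathKernel, pathKernelOn]
  refine tsum_congr fun γ => ?_
  rw [Set.indicator_of_mem (show γ ∈ {γ : G.Path a b | c ∉ γ.1.support} from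
    notMem_support_of_pendant hG γ.1 γ.2 ha hb)]

/-! ## The termwise comparison -/

/-- **One term of `S⁻ ≤ S⁺`.** For `0 < x`, a pairwise distinct interlaced quadruple `p₁ p₂ p₃ p₄` of `H`,
the induction hypothesis "interlacing-only TP₂ at `x` on every proper subgraph of `H`", a corner `p₃` with
a neighbour other than `p₄`, and any neighbour `u` of `p₃`:
`A(p₁,u) · A(p₂,p₄) ≤ A(p₁,p₂) · A(u,p₄)`, where `A(a,b)` is the kernel of the self-avoiding paths `a → b`
avoiding `p₃`. Cases `u ∉ {p₁,p₂,p₄}` (instance `(p₁,p₂,u,p₄)` of `H − p₃`), `u = p₂` (equality),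
`u = p₄` (instance `(p₁,p₂,p₃,p₄)` of `(H − p₃) + edge p₃p₄`), `u = p₁` (forced vertex `p₁`). [folklore] -/
theorem mainNonneg_term (x : ℝ) (hx : 0 < x) (H : SimpleGraph V) (p₁ p₂ p₃ p₄ u : V)
    (h₁₂ : p₁ ≠ p₂) (h₁₃ : p₁ ≠ p₃) (h₁₄ : p₁ ≠ p₄) (h₂₃ : p₂ ≠ p₃) (h₂₄ : p₂ ≠ p₄) (h₃₄ : p₃ ≠ p₄)
    (hI : Interlaced H p₁ p₂ p₃ p₄)
    (ih : ∀ H' : SimpleGraph V, H' ≤ H → H' ≠ H →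
      ∀ q₁ q₂ q₃ q₄ : V, q₁ ≠ q₂ → q₁ ≠ q₃ → q₁ ≠ q₄ → q₂ ≠ q₃ → q₂ ≠ q₄ → q₃ ≠ q₄ →
        Interlaced H' q₁ q₂ q₃ q₄ →
          pathKernel H' x q₁ q₃ * pathKernel H' x q₂ q₄ ≤ pathKernel H' x q₁ q₂ * pathKernel H' x q₃ q₄)
    (hnv : ∃ u, H.Adj p₃ u ∧ u ≠ p₄) (hu : H.Adj p₃ u) :
    pathKernelOn H x p₁ u {γ | p₃ ∉ γ.1.support} * pathKernelOn H x p₂ p₄ {γ | p₃ ∉ γ.1.support} ≤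
      pathKernelOn H x p₁ p₂ {γ | p₃ ∉ γ.1.support} * pathKernelOn H x u p₄ {γ | p₃ ∉ γ.1.support} := by
  -- the dictionary: avoiding kernels of `H` are kernels of `H − p₃`
  have hu₃ : u ≠ p₃ := hu.ne.symm
  rw [stub_pathKernelOn_avoid H x p₁ u p₃ h₁₃ hu₃, stub_pathKernelOn_avoid H x p₂ p₄ p₃ h₂₃ h₃₄.symm,
    stub_pathKernelOn_avoid H x p₁ p₂ p₃ h₁₃ h₂₃, stub_pathKernelOn_avoid H x u p₄ p₃ hu₃ h₃₄.symm]
  have hle : H.deleteEdges (H.incidenceSet p₃) ≤ H := SimpleGraph.deleteEdges_le _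
  by_cases hu₁ : u = p₁
  · -- `u = p₁`: `Z'(p₂,p₄) ≤ Z'(p₁,p₂) Z'(p₁,p₄)` by cutting at the forced vertex `p₁`
    subst hu₁
    rw [pathKernel_self, one_mul, pathKernel_comm _ x u p₂]
    refine pathKernel_le_mul_of_forall_mem_support _ x hx.le fun Q => ?_
    have hP : (SimpleGraph.Walk.cons hu.symm SimpleGraph.Walk.nil : H.Walk u p₃).IsPath := by
      rw [SimpleGraph.Walk.cons_isPath_iff, SimpleGraph.Walk.support_nil, List.mem_singleton]
      exact ⟨SimpleGraph.Walk.IsPath.nil, h₁₃⟩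
    obtain ⟨w, hwP, hwQ⟩ := hI ⟨_, hP⟩ ⟨Q.1.mapLe hle, Q.2.mapLe hle⟩
    rw [SimpleGraph.Walk.support_mapLe_eq_support] at hwQ
    rw [SimpleGraph.Walk.support_cons, SimpleGraph.Walk.support_nil, List.mem_cons,
      List.mem_singleton] at hwP
    rcases hwP with rfl | rfl
    · exact hwQ
    · exact absurd hwQ (notMem_support_of_walk_deleteEdges_incidenceSet Q.1 h₂₃ h₃₄.symm)
  by_cases hu₂ : u = p₂
  · -- `u = p₂`: both sides agree
    subst hu₂
    exact le_rfl
  by_cases hu₄ : u = p₄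
  · -- `u = p₄`: the instance `(p₁,p₂,p₃,p₄)` of the proper subgraph `G = (H − p₃) + edge p₃ p₄`
    subst hu₄
    rw [pathKernel_self, mul_one]
    obtain ⟨G, hG⟩ : ∃ G : SimpleGraph V, G = H.deleteEdges (H.incidenceSet p₃ \ {s(p₃, u)}) :=
      ⟨_, rfl⟩
    have hGle : G ≤ H := by rw [hG]; exact SimpleGraph.deleteEdges_le _
    -- in `G` the corner `p₃` is a pendant vertex hanging on `u`
    have hG3 : ∀ w, G.Adj p₃ w → w = u := by
      intro w hw
      rw [hG, SimpleGraph.deleteEdges_adj, Set.mem_sdiff, SimpleGraph.mk'_mem_incidenceSet_iff,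
        Set.mem_singleton_iff] at hw
      obtain ⟨hadj, hn⟩ := hw
      by_contra hne
      refine hn ⟨⟨hadj, Or.inl rfl⟩, fun heq => hne ?_⟩
      rcases Sym2.eq_iff.1 heq with ⟨-, h⟩ | ⟨h, -⟩
      · exact h
      · exact absurd h h₃₄
    have hG34 : G.Adj p₃ u := by
      rw [hG, SimpleGraph.deleteEdges_adj, Set.mem_sdiff, Set.mem_singleton_iff]
      exact ⟨hu, fun h => h.2 rfl⟩
    -- `G` is a proper subgraph: `p₃` has another neighbour in `H`
    have hGne : G ≠ H := by
      obtain ⟨u₀, hu₀, hu₀4⟩ := hnv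
      intro hGH
      have hu₀' : G.Adj p₃ u₀ := by rw [hGH]; exact hu₀
      exact hu₀4 (hG3 u₀ hu₀')
    -- deleting the pendant vertex of `G` gives back `H − p₃`
    have hK : G.deleteEdges (G.incidenceSet p₃) = H.deleteEdges (H.incidenceSet p₃) := by
      ext a b
      simp only [hG, SimpleGraph.deleteEdges_adj, Set.mem_sdiff, SimpleGraph.mk'_mem_incidenceSet_iff,
        Set.mem_singleton_iff]
      tauto
    have key := ih G hGle hGne p₁ p₂ p₃ u h₁₂ h₁₃ h₁₄ h₂₃ h₂₄ h₃₄ (hI.of_le hGle)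
    rw [pathKernel_pendant_to hG3 hG34 x hx.le h₁₃, pathKernel_pendant_other hG3 x h₂₃ hu₃,
      pathKernel_pendant_other hG3 x h₁₃ h₂₃, pathKernel_pendant_edge hG3 hG34 x hx.le, hK,
      mul_assoc, mul_comm _ (ENNReal.ofReal x)] at key
    exact (ENNReal.mul_le_mul_iff_right (ENNReal.ofReal_pos.2 hx).ne' ENNReal.ofReal_ne_top).1 key
  · -- `u ∉ {p₁, p₂, p₄}`: the instance `(p₁,p₂,u,p₄)` of the proper subgraph `H − p₃`
    have hne : H.deleteEdges (H.incidenceSet p₃) ≠ H := by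
      intro h
      have h' : (H.deleteEdges (H.incidenceSet p₃)).Adj p₃ u := by rw [h]; exact hu
      exact (ne_of_adj_deleteEdges_incidenceSet h').1 rfl
    exact ih _ hle hne p₁ p₂ u p₄ h₁₂ (Ne.symm hu₁) h₁₄ (Ne.symm hu₂) h₂₄ hu₄
      (stub_interlaced_deleteVert H p₁ p₂ p₃ p₄ u hI hu.symm h₁₃.symm h₂₃.symm h₃₄)

/-! ## The stub -/

/-- **`Main ≥ 0` from the induction hypothesis** (registered stub `stub_mainNonneg` of the line
`corner-deletion-induction` of crux `BoundaryTP2`). For `0 < x`, a subgraph `H ≤ ℤ²` with finitely many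
non-isolated vertices, a pairwise distinct interlaced quadruple `p₁ p₂ p₃ p₄`, the induction hypothesis
"interlacing-only TP₂ at `x` holds on every proper subgraph of `H`", and a corner `p₃` having a neighbour
other than `p₄`:
`S⁻ = Σ_{u ∼ p₃} A(p₁,u) A(p₂,p₄) ≤ Σ_{u ∼ p₃} A(p₁,p₂) A(u,p₄) = S⁺`, `A` the kernel of the self-avoiding
paths avoiding `p₃`. Termwise in `u` (`mainNonneg_term`): `u ∉ {p₁,p₂,p₄}` — the instance `(p₁,p₂,u,p₄)` of
`H − p₃`; `u = p₂` — equality; `u = p₄` — the instance `(p₁,p₂,p₃,p₄)` of `(H − p₃) + edge p₃p₄`;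
`u = p₁` — cutting at the vertex `p₁` forced by interlacing. (The hypotheses `H ≤ zdGraph 2` and finiteness
are part of the registered signature but not needed.) [folklore] -/
theorem stub_mainNonneg (x : ℝ) (hx : 0 < x) (H : SimpleGraph (Site 2)) (_hH : H ≤ zdGraph 2)
    (_hfin : H.support.Finite) (p₁ p₂ p₃ p₄ : Site 2)
    (h₁₂ : p₁ ≠ p₂) (h₁₃ : p₁ ≠ p₃) (h₁₄ : p₁ ≠ p₄) (h₂₃ : p₂ ≠ p₃) (h₂₄ : p₂ ≠ p₄) (h₃₄ : p₃ ≠ p₄)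
    (hI : Interlaced H p₁ p₂ p₃ p₄)
    (ih : ∀ H' : SimpleGraph (Site 2), H' ≤ H → H' ≠ H →
      ∀ q₁ q₂ q₃ q₄ : Site 2, q₁ ≠ q₂ → q₁ ≠ q₃ → q₁ ≠ q₄ → q₂ ≠ q₃ → q₂ ≠ q₄ → q₃ ≠ q₄ →
        Interlaced H' q₁ q₂ q₃ q₄ →
          pathKernel H' x q₁ q₃ * pathKernel H' x q₂ q₄ ≤ pathKernel H' x q₁ q₂ * pathKernel H' x q₃ q₄)
    (hnv : ∃ u, H.Adj p₃ u ∧ u ≠ p₄) :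
    (∑' u : H.neighborSet p₃,
        pathKernelOn H x p₁ u {γ | p₃ ∉ γ.1.support} * pathKernelOn H x p₂ p₄ {γ | p₃ ∉ γ.1.support}) ≤
      ∑' u : H.neighborSet p₃,
        pathKernelOn H x p₁ p₂ {γ | p₃ ∉ γ.1.support} * pathKernelOn H x u p₄ {γ | p₃ ∉ γ.1.support} :=
  ENNReal.tsum_le_tsum fun u =>
    mainNonneg_term x hx H p₁ p₂ p₃ p₄ u h₁₂ h₁₃ h₁₄ h₂₃ h₂₄ h₃₄ hI ih hnv u.2

end Summit.CriticalPhenomena.SAWScalingLimit.Theorems.BoundaryTP2
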